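import Summits.QuantumFields.BalabanUV.Beta.GAN24.DressedKernelOnFaceCurrent
import Summits.QuantumFields.BalabanUV.Beta.GAN24.CoarseBondCellPairing

/-!
# (C)sym at level 0 — THE REDUCED EE WORD: first bond over one coarse cell, inner slots resummed, AS ONE NUMBER (blueprint §4–§5 as corrected by
# C-leaf04-g65-1)

WHAT. With `X̃♮_0 = unitK s_f s_m (coDressKBmAt ρ Lc (KInvStep Lc 0))` (in-block root `ρ = toSite r`), `S^E = unitS s_f s_m (cE • wilsonA)`, `V_{κ,u} = vertexOfK X̃♮_0 Lc S^E κ u`,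
the exit-face indicator `𝟙f(n) = [n % Lc = Lc − 1]` and `K₁ = (Lc·s_m s_f·σ_0)·((s_f s_m)⁻¹ s_f⁻² cE)`, the REDUCED EE WORD is the level-0 EE exchange word of the dressed source
with its two inner Fubinis already performed — left leg `y` read at the `α`-exit face, the dressed kernel in the middle, the right half-vertex resummed over its bond `(ν, u′)`
and its `β`-exit-face leg `w`, the first bond `(μ, u)` summed over ONE CELL `box Lc` OF THE COARSE LATTICE:
`Σ_{u ∈ box Lc} Σ'_{y₁} Σ_a (Σ'_y 𝟙f(y_α)·V_{μ,u} y y₁ (inl α)(inl a)) · (Σ'_z Σ_b X̃♮_0 y₁ z (inl a)(inl b)·(Σ'_{u′} Σ'_w 𝟙f(w_β)·V_{ν,u′} z w (inl b)(inl β)))`.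

* §1 `coProjBmW_add_zsmul` (`Π_bm` of a block-periodic form is block-periodic), `shiftK_dressedStep` ∕ `unitS_wilsonA_translate` (block covariance of `X̃♮_0`, fine-translation
  covariance of `S^E`), **`leftFamily_cov`**: the left family `j_u(a, y₁) = Σ'_y 𝟙f(y_α)·V_{μ,u} y y₁ (inl α)(inl a)` is COARSE-BOND covariant, `j_{u+t}(a, y₁ + Lc•t) = j_u(a, y₁)`
  for every `t ∈ ℤ^{d+1}` (`OneStepKernelFamily.vertexOfK_translate`), `abs_leftFamily_le` (it decays off `Lc•u`: `VertexFamily` of the chain-rule vertex),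
  `summable_leftFamily_mul` (so it is summable against any bounded form);
* §2 **`ee_word_reduced`** (`μ ≠ α`, `ν ≠ β`, `1 ≤ Lc`, all units): THE REDUCED EE WORD `= |box Lc|·(−K₁²·s_f²·E·½·(1 − Lc⁻²)·Lc^{d−1})`, `E = [μ=ν][α=β] − [μ=β][α=ν]` —
  `DressedKernelOnFaceCurrent` §2 (the middle-and-right factor is the block-periodic form `s_f²·Π_bm(Γ_{Lc}·t_R)`), `CoarseBondCellPairing` (ALL `|box|` first-slot terms are
  equal to the cell pairing of the resummed left family), `DressedKernelOnFaceCurrent` §3–§4 (the cell value); **`ee_word_reduced'`**: the same with `|box Lc| = Lc^{d+1}` folded,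
  `= −K₁²·s_f²·E·½·Lc^{d−1}·(Lc^{d+1} − Lc^{d−1})` — the right side of `ee_word_value` v2 (`HOME/…/g65/EEWordTarget.v2.sorried.NOT-TO-FILE.lean`); what separates the two is
  only the OUTER Fubini `Σ'_{u′} Σ'_{(y,w)} ((V_{μ,u} ∘ X̃♮_0) ∘ V_{ν,u′}) ↔` the nested form above (`ExchangeSlotFubini`), not done here.

HONEST: [folklore] `tsum` ∕ finite cell algebra BY NAME over this lineage's GAN24 files and an2's `vertexOfK_translate`; no value of Bałaban's tables beyond an3's DEFINED stencil is
asserted; (C)sym stays DISPLAYED — nothing of (C)∕(Q-D)∕(Q-D-rate) is discharged; NEVER «G-an2-4 closed» as (CONV-C); NOT D1, NOT BetaPertH, NOT continuum, NOT Clay.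
-/

noncomputable section

open Finset
open scoped BigOperators
open Literature.MathematicalPhysics.QuantumFieldTheory
open Literature.MathematicalPhysics.QuantumFieldTheory.Balaban1983to89
open Literature.MathematicalPhysics.QuantumFieldTheory.Balaban1983to89.Beta
open B12Sec2to5 (l1 l1_nonneg)
open ExpKernelCalculus (Site MKer shiftK Decays BiLoc VertexFamily summable_exp_shift')
open OneStepResolventKernel (Fib LocStencil)
open OneStepKernelFamily (KInvStep vertexOfK vertexOfK_translate vertexFamily_vertexOfK decays_KInvStep shiftK_KInvStep)
open StepJetData (wilsonA wilsonA_translate locStencil_wilsonA locStencil_smul)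
open AffineAveraging (Form1 Form2 box toSite curvAdj)
open KKTFluctuationKernel (Gam)
open PeriodicDescent (IsPeriodic)
open Summit.QuantumFields.BalabanUV.Beta.AxialDressingRooted (coDressKBmAt coProjBmW coProjBmW_apply pmBm_shift shiftK_coDressKBmAt decays_coDressKBmAt)
open Summit.QuantumFields.BalabanUV.Beta.HessKerDressedUnits (unitK unitS counitK decays_unitK locStencil_unitS)
open Summit.QuantumFields.BalabanUV.Beta.GAN24.PeriodicForceMultiplier (bounded_of_periodic)
open Summit.QuantumFields.BalabanUV.Beta.GAN24.DressedKernelOnFaceCurrent (smul_curvAdj_periodic facePlaq_periodic tsum_dressedStep_zero_inl_mul_halfVertex_snd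
  tsum_faceHalfVertex_fst sum_box_leftFamily_mul_dressed_halfVertex_snd)
open Summit.QuantumFields.BalabanUV.Beta.GAN24.CoarseBondCellPairing (sum_box_tsum_sum_mul_periodic_of_cov)

namespace Summit.QuantumFields.BalabanUV.Beta.GAN24.EEWordReduced

variable {d : ℕ}

/-! ## §1 Periodicity of `Π_bm`, covariance and decay of the left family -/

/-- [folklore] `Π_bm` OF A BLOCK-PERIODIC FORM IS BLOCK-PERIODIC (the window matrix is block-covariant, `AxialDressingRooted.pmBm_shift`). -/
theorem coProjBmW_add_zsmul (ρ : Site (d + 1)) {N : ℕ} (hN : 1 ≤ N) {A : Form1 (d + 1) ℝ} (hA : ∀ κ (y z : Site (d + 1)), A κ (y + (N : ℤ) • z) = A κ y)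
    (κ' : Fin (d + 1)) (u' z : Site (d + 1)) : coProjBmW ρ N A κ' (u' + (N : ℤ) • z) = coProjBmW ρ N A κ' u' := by
  simp only [coProjBmW_apply]
  refine Finset.sum_congr rfl fun v _ => Finset.sum_congr rfl fun κ _ => ?_
  rw [show u' + (N : ℤ) • z - v = (u' - v) + (N : ℤ) • z by abel, pmBm_shift ρ hN, hA]

section Dressed

variable {Lc : ℕ} [NeZero Lc] {r : Fin (d + 1) → ℕ}

/-- [folklore] The unit-dressed co-dressed step kernel is block-covariant (`shiftK_coDressKBmAt` ⨾ `shiftK_KInvStep`; units are leg-type constants). -/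
theorem shiftK_dressedStep (hLc : 1 ≤ Lc) (sf sm : ℝ) (j : ℕ) (t : Site (d + 1)) :
    shiftK (-((Lc : ℤ) • t)) (unitK sf sm (coDressKBmAt (toSite r) Lc (KInvStep (d := d) Lc j))) = unitK sf sm (coDressKBmAt (toSite r) Lc (KInvStep (d := d) Lc j)) := by
  show unitK sf sm (shiftK (-((Lc : ℤ) • t)) (coDressKBmAt (toSite r) Lc (KInvStep (d := d) Lc j))) = _
  rw [shiftK_coDressKBmAt (toSite r) hLc (shiftK_KInvStep (d := d) (Lc := Lc) j) t]

omit [NeZero Lc] in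
/-- [folklore] The unit-dressed Wilson table is fine-translation covariant (`StepJetData.wilsonA_translate`; units and the scalar are position-independent). -/
theorem unitS_wilsonA_translate (sf sm cE : ℝ) (κ' : Fin (d + 1)) (u v : Site (d + 1)) :
    unitS sf sm (fun κ v => cE • wilsonA d κ v) κ' (u + v) = shiftK (-v) (unitS sf sm (fun κ v => cE • wilsonA d κ v) κ' u) := by
  show (sf * sm)⁻¹ • counitK sf sm (cE • wilsonA d κ' (u + v)) = shiftK (-v) ((sf * sm)⁻¹ • counitK sf sm (cE • wilsonA d κ' u))
  rw [wilsonA_translate]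
  rfl

variable {μ α : Fin (d + 1)}

/-- [folklore] **THE LEFT FAMILY IS COARSE-BOND COVARIANT**: `j_{u+t}(a, y₁ + Lc•t) = j_u(a, y₁)` for every `t ∈ ℤ^{d+1}`, where
`j_u(a, y₁) = Σ'_y 𝟙f(y_α)·vertexOfK X̃♮_j Lc S^E μ u y y₁ (inl α)(inl a)` (`vertexOfK_translate`, then the reindexing `y ↦ y − Lc•t` under which `𝟙f` is invariant). -/
theorem leftFamily_cov (hLc : 1 ≤ Lc) (sf sm cE : ℝ) (j : ℕ) (u : Site (d + 1)) (a : Fin (d + 1)) (y₁ t : Site (d + 1)) :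
    ∑' y : Site (d + 1), (if y α % (Lc : ℤ) = (Lc : ℤ) - 1 then (1 : ℝ) else 0) *
        vertexOfK (unitK sf sm (coDressKBmAt (toSite r) Lc (KInvStep (d := d) Lc j))) Lc (unitS sf sm (fun κ v => cE • wilsonA d κ v)) μ (u + t) y (y₁ + (Lc : ℤ) • t)
          (Sum.inl α) (Sum.inl a) =
      ∑' y : Site (d + 1), (if y α % (Lc : ℤ) = (Lc : ℤ) - 1 then (1 : ℝ) else 0) *
        vertexOfK (unitK sf sm (coDressKBmAt (toSite r) Lc (KInvStep (d := d) Lc j))) Lc (unitS sf sm (fun κ v => cE • wilsonA d κ v)) μ u y y₁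
          (Sum.inl α) (Sum.inl a) := by
  have hV := vertexOfK_translate (N := Lc) (shiftK_dressedStep (r := r) hLc sf sm j) (unitS_wilsonA_translate (d := d) sf sm cE) μ u t
  simp only [hV, shiftK, add_neg_cancel_right]
  have hf : ∀ y : Site (d + 1), (if (y + -((Lc : ℤ) • t)) α % (Lc : ℤ) = (Lc : ℤ) - 1 then (1 : ℝ) else 0) = (if y α % (Lc : ℤ) = (Lc : ℤ) - 1 then (1 : ℝ) else 0) := by
    intro y
    have e : (y + -((Lc : ℤ) • t)) α % (Lc : ℤ) = y α % (Lc : ℤ) := by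
      simp only [Pi.add_apply, Pi.neg_apply, Pi.smul_apply, smul_eq_mul]
      rw [show y α + -((Lc : ℤ) * t α) = y α + (Lc : ℤ) * (-t α) by ring, Int.add_mul_emod_self_left]
    simp only [e]
  calc ∑' y : Site (d + 1), (if y α % (Lc : ℤ) = (Lc : ℤ) - 1 then (1 : ℝ) else 0) *
        vertexOfK (unitK sf sm (coDressKBmAt (toSite r) Lc (KInvStep (d := d) Lc j))) Lc (unitS sf sm (fun κ v => cE • wilsonA d κ v)) μ u (y + -((Lc : ℤ) • t)) y₁
          (Sum.inl α) (Sum.inl a)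
      = ∑' y : Site (d + 1), (if (y + -((Lc : ℤ) • t)) α % (Lc : ℤ) = (Lc : ℤ) - 1 then (1 : ℝ) else 0) *
        vertexOfK (unitK sf sm (coDressKBmAt (toSite r) Lc (KInvStep (d := d) Lc j))) Lc (unitS sf sm (fun κ v => cE • wilsonA d κ v)) μ u (y + -((Lc : ℤ) • t)) y₁
          (Sum.inl α) (Sum.inl a) := tsum_congr fun y => by rw [hf]
    _ = _ := (Equiv.addRight (-((Lc : ℤ) • t))).tsum_eq (fun y : Site (d + 1) => (if y α % (Lc : ℤ) = (Lc : ℤ) - 1 then (1 : ℝ) else 0) *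
        vertexOfK (unitK sf sm (coDressKBmAt (toSite r) Lc (KInvStep (d := d) Lc j))) Lc (unitS sf sm (fun κ v => cE • wilsonA d κ v)) μ u y y₁ (Sum.inl α) (Sum.inl a))

/-- [folklore] **THE LEFT FAMILY DECAYS OFF ITS SOURCE**: `|j_u(a, y₁)| ≤ (C_v·Σ'_y e^{−δ_v|y − Lc•u|})·e^{−δ_v|y₁ − Lc•u|}` for the `VertexFamily` constants of the chain-rule vertex
(`vertexFamily_vertexOfK` over `decays_coDressKBmAt` ∕ `decays_unitK` ∕ `locStencil_wilsonA` ∕ `locStencil_unitS`). -/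
theorem abs_leftFamily_le (hLc : 1 ≤ Lc) (hr : r ∈ box (d + 1) Lc) (sf sm cE : ℝ) (j : ℕ) :
    ∃ Cv δv : ℝ, 0 < δv ∧ 0 ≤ Cv ∧ ∀ (u : Site (d + 1)) (a : Fin (d + 1)) (y₁ : Site (d + 1)),
      |∑' y : Site (d + 1), (if y α % (Lc : ℤ) = (Lc : ℤ) - 1 then (1 : ℝ) else 0) *
          vertexOfK (unitK sf sm (coDressKBmAt (toSite r) Lc (KInvStep (d := d) Lc j))) Lc (unitS sf sm (fun κ v => cE • wilsonA d κ v)) μ u y y₁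
            (Sum.inl α) (Sum.inl a)| ≤
        (Cv * ∑' y : Site (d + 1), Real.exp (-δv * l1 (y - (Lc : ℤ) • u))) * Real.exp (-δv * l1 (y₁ - (Lc : ℤ) • u)) := by
  obtain ⟨δK, CK, hδK, hCK, hXd⟩ := decays_coDressKBmAt hLc hr (decays_KInvStep (d := d) (Lc := Lc) j)
  have hXu := decays_unitK (sf := sf) (sm := sm) hXd
  have hS := locStencil_unitS (sf := sf) (sm := sm) (locStencil_smul cE (locStencil_wilsonA (d := d) hδK.le))
  have hC : 0 ≤ max |sf| |sm| * CK * max |sf| |sm| := by positivity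
  obtain ⟨Cv, hVF⟩ : ∃ Cv : ℝ, VertexFamily (vertexOfK (unitK sf sm (coDressKBmAt (toSite r) Lc (KInvStep (d := d) Lc j))) Lc
      (unitS sf sm (fun κ v => cE • wilsonA d κ v))) Lc Cv (δK / 2) := ⟨_, vertexFamily_vertexOfK (N := Lc) hXu hC hS hδK le_rfl⟩
  set V := vertexOfK (unitK sf sm (coDressKBmAt (toSite r) Lc (KInvStep (d := d) Lc j))) Lc (unitS sf sm (fun κ v => cE • wilsonA d κ v)) with hVdef
  have hCv0 : 0 ≤ Cv := (hVF μ 0).nonneg (Sum.inl 0)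
  refine ⟨Cv, δK / 2, half_pos hδK, hCv0, fun u a y₁ => ?_⟩
  have hpt : ∀ y : Site (d + 1), |(if y α % (Lc : ℤ) = (Lc : ℤ) - 1 then (1 : ℝ) else 0) * V μ u y y₁ (Sum.inl α) (Sum.inl a)| ≤
      Cv * Real.exp (-(δK / 2) * l1 (y - (Lc : ℤ) • u)) * Real.exp (-(δK / 2) * l1 (y₁ - (Lc : ℤ) • u)) := by
    intro y
    rw [abs_mul]
    have h1 : |(if y α % (Lc : ℤ) = (Lc : ℤ) - 1 then (1 : ℝ) else 0)| ≤ 1 := by split_ifs <;> simp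
    have h2 := hVF μ u y y₁ (Sum.inl α) (Sum.inl a)
    rw [mul_add, Real.exp_add, ← mul_assoc] at h2
    calc |(if y α % (Lc : ℤ) = (Lc : ℤ) - 1 then (1 : ℝ) else 0)| * |V μ u y y₁ (Sum.inl α) (Sum.inl a)|
        ≤ 1 * (Cv * Real.exp (-(δK / 2) * l1 (y - (Lc : ℤ) • u)) * Real.exp (-(δK / 2) * l1 (y₁ - (Lc : ℤ) • u))) :=
          mul_le_mul h1 h2 (abs_nonneg _) zero_le_one
      _ = _ := one_mul _
  have hZ : Summable fun y : Site (d + 1) => Real.exp (-(δK / 2) * l1 (y - (Lc : ℤ) • u)) := summable_exp_shift' (half_pos hδK) ((Lc : ℤ) • u)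
  have hmaj : Summable fun y : Site (d + 1) => Cv * Real.exp (-(δK / 2) * l1 (y - (Lc : ℤ) • u)) * Real.exp (-(δK / 2) * l1 (y₁ - (Lc : ℤ) • u)) :=
    (hZ.mul_left Cv).mul_right _
  have hsy : Summable fun y : Site (d + 1) => ‖(if y α % (Lc : ℤ) = (Lc : ℤ) - 1 then (1 : ℝ) else 0) * V μ u y y₁ (Sum.inl α) (Sum.inl a)‖ :=
    Summable.of_nonneg_of_le (fun _ => norm_nonneg _) (fun y => by rw [Real.norm_eq_abs]; exact hpt y) hmaj
  calc |∑' y : Site (d + 1), (if y α % (Lc : ℤ) = (Lc : ℤ) - 1 then (1 : ℝ) else 0) * V μ u y y₁ (Sum.inl α) (Sum.inl a)|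
      ≤ ∑' y : Site (d + 1), ‖(if y α % (Lc : ℤ) = (Lc : ℤ) - 1 then (1 : ℝ) else 0) * V μ u y y₁ (Sum.inl α) (Sum.inl a)‖ := by
        rw [← Real.norm_eq_abs]; exact norm_tsum_le_tsum_norm hsy
    _ ≤ ∑' y : Site (d + 1), Cv * Real.exp (-(δK / 2) * l1 (y - (Lc : ℤ) • u)) * Real.exp (-(δK / 2) * l1 (y₁ - (Lc : ℤ) • u)) :=
        Summable.tsum_le_tsum (fun y => by rw [Real.norm_eq_abs]; exact hpt y) hsy hmaj
    _ = (Cv * ∑' y : Site (d + 1), Real.exp (-(δK / 2) * l1 (y - (Lc : ℤ) • u))) * Real.exp (-(δK / 2) * l1 (y₁ - (Lc : ℤ) • u)) := by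
        rw [tsum_mul_right, tsum_mul_left]

/-- [folklore] **THE LEFT FAMILY IS SUMMABLE AGAINST ANY BOUNDED FORM** (exponential majorant of `abs_leftFamily_le`). -/
theorem summable_leftFamily_mul (hLc : 1 ≤ Lc) (hr : r ∈ box (d + 1) Lc) (sf sm cE : ℝ) (j : ℕ) {B : Site (d + 1) → ℝ} {M : ℝ} (hB : ∀ y, |B y| ≤ M)
    (u : Site (d + 1)) (a : Fin (d + 1)) :
    Summable fun y₁ : Site (d + 1) => (∑' y : Site (d + 1), (if y α % (Lc : ℤ) = (Lc : ℤ) - 1 then (1 : ℝ) else 0) *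
        vertexOfK (unitK sf sm (coDressKBmAt (toSite r) Lc (KInvStep (d := d) Lc j))) Lc (unitS sf sm (fun κ v => cE • wilsonA d κ v)) μ u y y₁
          (Sum.inl α) (Sum.inl a)) * B y₁ := by
  obtain ⟨Cv, δv, hδv, hCv, hle⟩ := abs_leftFamily_le (μ := μ) (α := α) hLc hr sf sm cE j
  have hM : 0 ≤ M := (abs_nonneg _).trans (hB 0)
  have hZ0 : 0 ≤ ∑' y : Site (d + 1), Real.exp (-δv * l1 (y - (Lc : ℤ) • u)) := tsum_nonneg fun _ => (Real.exp_pos _).le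
  refine Summable.of_norm_bounded ((((summable_exp_shift' hδv ((Lc : ℤ) • u)).mul_left
    (Cv * ∑' y : Site (d + 1), Real.exp (-δv * l1 (y - (Lc : ℤ) • u)))).mul_right M)) (fun y₁ => ?_)
  rw [Real.norm_eq_abs, abs_mul]
  exact mul_le_mul (hle u a y₁) (hB y₁) (abs_nonneg _) (by positivity)

end Dressed

/-! ## §2 The reduced EE word -/

section Reduced

variable {Lc : ℕ} [NeZero Lc] {r : Fin (d + 1) → ℕ} {μ ν α β : Fin (d + 1)}

/-- [folklore] **THE REDUCED EE WORD AS ONE NUMBER** (in-block root, `1 ≤ Lc`, all units, `μ ≠ α`, `ν ≠ β`):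
`Σ_{u ∈ box Lc} Σ'_{y₁} Σ_a j_u(a, y₁)·(Σ'_z Σ_b X̃♮_0 y₁ z (inl a)(inl b)·t̃_R(b, z)) = |box Lc|·(−K₁²·s_f²·E·½·(1 − Lc⁻²)·Lc^{d−1})`, where `j_u` is the exit-face-read left family,
`t̃_R(b, z) = Σ'_{u′} Σ'_w 𝟙f(w_β)·V_{ν,u′} z w (inl b)(inl β)` the background-resummed exit-face-read right half-vertex and `E = [μ=ν][α=β] − [μ=β][α=ν]`. -/
theorem ee_word_reduced (hμα : μ ≠ α) (hνβ : ν ≠ β) (hLc : 1 ≤ Lc) (hr : r ∈ box (d + 1) Lc) (sf sm cE : ℝ) :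
    ∑ u ∈ box (d + 1) Lc, ∑' y₁ : Site (d + 1), ∑ a : Fin (d + 1),
        (∑' y : Site (d + 1), (if y α % (Lc : ℤ) = (Lc : ℤ) - 1 then (1 : ℝ) else 0) *
          vertexOfK (unitK sf sm (coDressKBmAt (toSite r) Lc (KInvStep (d := d) Lc 0))) Lc (unitS sf sm (fun κ v => cE • wilsonA d κ v)) μ (toSite u) y y₁
            (Sum.inl α) (Sum.inl a)) *
        (∑' z : Site (d + 1), ∑ b : Fin (d + 1), unitK sf sm (coDressKBmAt (toSite r) Lc (KInvStep (d := d) Lc 0)) y₁ z (Sum.inl a) (Sum.inl b) *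
          (∑' u' : Site (d + 1), ∑' w : Site (d + 1), (if w β % (Lc : ℤ) = (Lc : ℤ) - 1 then (1 : ℝ) else 0) *
            vertexOfK (unitK sf sm (coDressKBmAt (toSite r) Lc (KInvStep (d := d) Lc 0))) Lc (unitS sf sm (fun κ v => cE • wilsonA d κ v)) ν u' z w
              (Sum.inl b) (Sum.inl β))) =
      ((box (d + 1) Lc).card : ℝ) *
        (-((((Lc : ℝ) * (sm * sf)) * ((((Lc ^ (0 + 1) : ℕ) : ℝ)) ^ (d + 1 + 1))⁻¹) * ((sf * sm)⁻¹ * (sf⁻¹ * sf⁻¹) * cE)) ^ 2 * (sf * sf) *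
          (((if μ = ν ∧ α = β then (1 : ℝ) else 0) - (if μ = β ∧ α = ν then (1 : ℝ) else 0)) * ((1 / 2 : ℝ) * (1 - ((Lc : ℝ) ^ 2)⁻¹) * (Lc : ℝ) ^ (d - 1)))) := by
  -- the middle-and-right factor is the block-periodic bounded form `s_f²·Π_bm(Γ·t_R)`
  simp only [tsum_dressedStep_zero_inl_mul_halfVertex_snd hνβ hLc hr sf sm cE]
  set Fνβ : Form2 (d + 1) ℝ := fun κ l (x : Site (d + 1)) =>
    (if κ = ν ∧ l = β then (if x ν % (Lc : ℤ) = (Lc : ℤ) - 1 then (1 : ℝ) else 0) * (if x β % (Lc : ℤ) = (Lc : ℤ) - 1 then (1 : ℝ) else 0) else 0) -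
    (if κ = β ∧ l = ν then (if x ν % (Lc : ℤ) = (Lc : ℤ) - 1 then (1 : ℝ) else 0) * (if x β % (Lc : ℤ) = (Lc : ℤ) - 1 then (1 : ℝ) else 0) else 0) with hFνβ
  set K₁ : ℝ := (((Lc : ℝ) * (sm * sf)) * ((((Lc ^ (0 + 1) : ℕ) : ℝ)) ^ (d + 1 + 1))⁻¹) * ((sf * sm)⁻¹ * (sf⁻¹ * sf⁻¹) * cE) with hK₁
  set A : Form1 (d + 1) ℝ := fun κ u => ∑' u'' : Site (d + 1), ∑ κ' : Fin (d + 1), (K₁ * ((1 / 2 : ℝ) * curvAdj Fνβ κ' u'')) * Gam (N := Lc) κ u κ' u'' with hA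
  have hGp : ∀ κ l, IsPeriodic Lc (Fνβ κ l) := facePlaq_periodic (d := d) Lc ν β
  have hAp : ∀ κ (y z : Site (d + 1)), A κ (y + (Lc : ℤ) • z) = A κ y := by
    intro κ y z
    simp only [hA]
    exact PeriodicKKTResponse.respA_periodic (N := Lc) (fun l y s => by
      have h := smul_curvAdj_periodic (N := Lc) hGp (1 / 2 : ℝ) l y s
      rw [h]) κ y z
  have hA'p : ∀ (a : Fin (d + 1)) (y z : Site (d + 1)), (sf * sf) * coProjBmW (toSite r) Lc A a (y + (Lc : ℤ) • z) = (sf * sf) * coProjBmW (toSite r) Lc A a y :=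
    fun a y z => by rw [coProjBmW_add_zsmul (toSite r) hLc hAp]
  -- all `|box|` first-slot terms are equal to the cell pairing of the resummed left family
  have h13 := sum_box_tsum_sum_mul_periodic_of_cov (N := Lc)
    (j := fun (u : Site (d + 1)) (a : Fin (d + 1)) (y₁ : Site (d + 1)) => ∑' y : Site (d + 1), (if y α % (Lc : ℤ) = (Lc : ℤ) - 1 then (1 : ℝ) else 0) *
      vertexOfK (unitK sf sm (coDressKBmAt (toSite r) Lc (KInvStep (d := d) Lc 0))) Lc (unitS sf sm (fun κ v => cE • wilsonA d κ v)) μ u y y₁ (Sum.inl α) (Sum.inl a))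
    (A := fun a y₁ => (sf * sf) * coProjBmW (toSite r) Lc A a y₁)
    (fun u a y₁ t => leftFamily_cov (r := r) (μ := μ) (α := α) hLc sf sm cE 0 u a y₁ t) hA'p
    (fun u a => summable_leftFamily_mul (μ := μ) (α := α) hLc hr sf sm cE 0
      (bounded_of_periodic (Lc := Lc) (V := fun y => (sf * sf) * coProjBmW (toSite r) Lc A a y) (fun y z => hA'p a y z)) u a)
  beta_reduce at h13
  rw [h13]
  -- the resummed left family and the cell value
  simp only [tsum_faceHalfVertex_fst hμα hLc hr sf sm cE 0]
  rw [sum_box_leftFamily_mul_dressed_halfVertex_snd hνβ hLc hr sf sm cE]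

/-- [folklore] **THE REDUCED EE WORD, `|box Lc| = Lc^{d+1}` FOLDED**: `= −K₁²·s_f²·E·½·Lc^{d−1}·(Lc^{d+1} − Lc^{d−1})` — the right side of the corrected target `ee_word_value` v2
(blueprint §5 with C-leaf04-g65-1). -/
theorem ee_word_reduced' (hμα : μ ≠ α) (hνβ : ν ≠ β) (hLc : 1 ≤ Lc) (hr : r ∈ box (d + 1) Lc) (sf sm cE : ℝ) :
    ∑ u ∈ box (d + 1) Lc, ∑' y₁ : Site (d + 1), ∑ a : Fin (d + 1),
        (∑' y : Site (d + 1), (if y α % (Lc : ℤ) = (Lc : ℤ) - 1 then (1 : ℝ) else 0) *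
          vertexOfK (unitK sf sm (coDressKBmAt (toSite r) Lc (KInvStep (d := d) Lc 0))) Lc (unitS sf sm (fun κ v => cE • wilsonA d κ v)) μ (toSite u) y y₁
            (Sum.inl α) (Sum.inl a)) *
        (∑' z : Site (d + 1), ∑ b : Fin (d + 1), unitK sf sm (coDressKBmAt (toSite r) Lc (KInvStep (d := d) Lc 0)) y₁ z (Sum.inl a) (Sum.inl b) *
          (∑' u' : Site (d + 1), ∑' w : Site (d + 1), (if w β % (Lc : ℤ) = (Lc : ℤ) - 1 then (1 : ℝ) else 0) *
            vertexOfK (unitK sf sm (coDressKBmAt (toSite r) Lc (KInvStep (d := d) Lc 0))) Lc (unitS sf sm (fun κ v => cE • wilsonA d κ v)) ν u' z w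
              (Sum.inl b) (Sum.inl β))) =
      -((((Lc : ℝ) * (sm * sf)) * ((((Lc ^ (0 + 1) : ℕ) : ℝ)) ^ (d + 1 + 1))⁻¹) * ((sf * sm)⁻¹ * (sf⁻¹ * sf⁻¹) * cE)) ^ 2 * (sf * sf) *
        (((if μ = ν ∧ α = β then (1 : ℝ) else 0) - (if μ = β ∧ α = ν then (1 : ℝ) else 0)) *
          ((1 / 2 : ℝ) * (Lc : ℝ) ^ (d - 1) * ((Lc : ℝ) ^ (d + 1) - (Lc : ℝ) ^ (d - 1)))) := by
  rw [ee_word_reduced hμα hνβ hLc hr sf sm cE]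
  have hcard : ((box (d + 1) Lc).card : ℝ) = (Lc : ℝ) ^ (d + 1) := by
    have h' : (box (d + 1) Lc).card = Lc ^ (d + 1) := by
      simp [AffineAveraging.box, Fintype.card_piFinset, Finset.card_range, Finset.prod_const, Finset.card_univ, Fintype.card_fin]
    rw [h']; push_cast; rfl
  have hL0 : (Lc : ℝ) ≠ 0 := Nat.cast_ne_zero.2 (NeZero.ne Lc)
  have hd : 1 ≤ d := by
    by_contra h0
    have hν := ν.isLt
    have hβ := β.isLt
    exact hνβ (Fin.ext (by omega))
  have hpow : (Lc : ℝ) ^ (d + 1) = (Lc : ℝ) ^ (d - 1) * (Lc : ℝ) ^ 2 := by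
    rw [← pow_add]; congr 1; omega
  rw [hcard, hpow]
  field_simp

end Reduced

end Summit.QuantumFields.BalabanUV.Beta.GAN24.EEWordReduced

end
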